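import Literature.Probability.LatticeModels.HighDimTrivialityWick
import Literature.Probability.LatticeModels.GaussianPairingBound
import Literature.Probability.LatticeModels.CriticalGibbsUniqueness
import Literature.Probability.LatticeModels.PlanarIsing
import HarnessLib

/-!
# High-dimensional triviality of Ising scaling limits, II: Gaussian domination of the even moments — proofs

Topic `Literature/Probability/LatticeModels`; sibling proof file of `HighDimTrivialityMoments.lean`,
whose named fact `newman_evenMoment_le` (Gaussian domination of the even moments of the smeared
field `T_{f,L}`, `f ≥ 0`: `⟨T_{f,L}^{2n}⟩_μ ≤ (2n)!/(2ⁿ n!) ⟨T_{f,L}²⟩_μⁿ` for every DLR state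
`μ ∈ 𝒢(β, 0)`, `0 ≤ β ≤ β_c(d)`, `d ≥ 2`) is the smeared form of the lower inequality

  `0 ≤ 𝒢_n[S_β](x₁,…,x_{2n}) - S_β(x₁,…,x_{2n})`

of the first display of

* M. Aizenman, H. Duminil-Copin, *Marginal triviality of the scaling limits of critical 4D Ising
  and `φ⁴₄` models*, Ann. of Math. 194 (2021) = arXiv:1912.07973, §6.3, p. 26 ("the inequality,
  valid for every `n ≥ 2` and derived using the switching lemma in [Aiz82]"; read: p. 26 of the
  held arXiv version), where `S_β` is *the* infinite-volume state at `β ≤ β_c` and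
  `𝒢_n[S₂] = ∑_{pairings} ∏ S₂` (§1.1); as an inequality for zero-field ferromagnets it is
  Newman's Gaussian inequality (Z. Wahrsch. verw. Gebiete 33 (1975), Thm. 3).

## The proof assembled here (every input is a theorem of the tree)

1. `aizenman_nPoint_le_pairingSum_finite_holds` (`GaussianPairingBound`): the inequality for the
   free-boundary, zero-field model in a finite volume `Λ ⊂ ℤ^d` (random currents + switching lemma).
2. `pairingLowerBound_of_finite` (`HighDimTrivialityWick`, Part M): it passes to every state whose
   correlations are the free box limits `⟨σ_A⟩^∅_{β,0}` (`hasBoxLimit_isingCorr_free_holds`).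
3. `exists_freeMeasure_holds` (`FreeStateGibbs`): the free state `μ^∅_{β,0} ∈ 𝒢(β,0)` has these
   correlations; hence **uniqueness of the Gibbs measure identifies every `μ ∈ 𝒢(β,0)` with it**
   (`spinCorr_eq_freeCorr_of_hasUniqueGibbsMeasure`, `pairingLowerBound_of_hasUniqueGibbsMeasure`).
4. Uniqueness: `hasUniqueGibbsMeasure_of_lt_criticalBeta_holds` (`β < β_c`, Lebowitz–Martin-Löf) and
   `hasUniqueGibbsMeasure_criticalBeta_holds` (`β = β_c`, `d ≥ 3`, Aizenman–Duminil-Copin–Sidoravicius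
   2015), both in `CriticalGibbsUniqueness`.
5. `integral_normalizedField_pow_le_of_pairingLowerBound` / `newman_evenMoment_le_of_pointwise`
   (`HighDimTrivialityWick`, Part K): smearing against `∏ᵢ f(xᵢ/L) ≥ 0`.

## What is proved, and the one remaining input

* **Unconditionally**: the pointwise inequality `PairingLowerBound μ` and the moment inequality for
  every `μ ∈ 𝒢(β,0)` with `0 ≤ β < β_c(d)` (`d ≥ 2`), and with `0 ≤ β ≤ β_c(d)` for `d ≥ 3`
  (`pairingLowerBound_of_lt_criticalBeta`, `pairingLowerBound_of_le_criticalBeta`,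
  `integral_normalizedField_pow_le_wick_of_lt_criticalBeta`,
  `integral_normalizedField_pow_le_wick_of_three_le`) — this covers every use of the fact in the
  tree (`d = 4`, `d ≥ 5`).
* The corner `d = 2`, `β = β_c(2)` of the printed range needs `|𝒢(β_c(2), 0)| = 1` on `ℤ²`, i.e.
  the continuity of the planar magnetisation `m*(β_c(2)) = 0` (Yang 1952; Onsager–Yang via
  Benettin–Gallavotti–Jona-Lasinio–Stella 1973), which the tree records as the named facts
  `criticalBeta_two` and `spontaneousMagnetization_two_criticalBetaTwo` of `PlanarIsing` (not yet
  discharged). For a state that is not known to be the (even, free) state no Gaussian bound is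
  available, so uniqueness is genuinely the input. We prove the full facts
  `aizenman_nPoint_le_pairingSum` (`HighDimTrivialityWick`, Part J) and `newman_evenMoment_le` from
  uniqueness at `(2, β_c(2))` (`…_of_hasUniqueGibbsMeasure_two`), from `m*(β_c(2)) = 0`
  (`…_of_planarContinuity`), and from the two named facts (`…_of_planar_facts`); the discharges
  `…_holds` then are one-liners once `spontaneousMagnetization_two_criticalBetaTwo_holds` and
  `criticalBeta_two_holds` land.

No new definitions, no new named facts.
-/

noncomputable section

open MeasureTheory
open scoped Nat

namespace Literature.Probability.LatticeModels

variable {d : ℕ}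

/-! ### Uniqueness identifies every DLR state with the free state -/

/-- **`m*(β) = 0 ⇒ |𝒢(β,0)| = 1`** (Lebowitz–Martin-Löf 1972; Aizenman–Duminil-Copin–Sidoravicius
2015, Prop. B.1; Friedli–Velenik 2017, Thm. 3.28 with Prop. 3.29), for the nearest-neighbour model on
`ℤ^d` at `β ≥ 0`: from the tree theorems `hasUniqueGibbsMeasure_of_plusExpect_spinAt_eq_zero_holds`
and `⟨σ_x⟩⁺_β = m*(β)` (`plusExpect_spinAt_eq_spontaneousMagnetization_holds`). [cite: AizenmanDuminilCopinSidoraviciusCMP2015, Prop. B.1 (Appendix B)] -/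
theorem hasUniqueGibbsMeasure_of_spontaneousMagnetization_eq_zero {β : ℝ} (hβ : 0 ≤ β)
    (hm : spontaneousMagnetization d β = 0) :
    HasUniqueGibbsMeasure (isingSpecification (zdGraph d) β 0) :=
  hasUniqueGibbsMeasure_of_plusExpect_spinAt_eq_zero_holds hβ fun x =>
    (plusExpect_spinAt_eq_spontaneousMagnetization_holds hβ x).trans hm

/-- **In the uniqueness regime every DLR state has the free correlations**: if `|𝒢(β,0)| = 1`
(`β ≥ 0`) then `⟨σ_A⟩_μ = ⟨σ_A⟩^∅_{β,0}` for every `μ ∈ 𝒢(β,0)` and every finite `A ⊂ ℤ^d` — `μ` is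
the free state of `exists_freeMeasure_holds` (Friedli–Velenik 2017, Thm. 6.26 with Exercise 3.16 and
Lemma 3.30). [cite: FriedliVelenik2017, Thm. 6.26 with Exercise 3.16] -/
theorem spinCorr_eq_freeCorr_of_hasUniqueGibbsMeasure {β : ℝ} (hβ : 0 ≤ β)
    (huniq : HasUniqueGibbsMeasure (isingSpecification (zdGraph d) β 0))
    {μ : Measure (SpinConfig (Site d))} (hμ : μ ∈ isingGibbsMeasures d β 0)
    (A : Finset (Site d)) : spinCorr μ A = freeCorr d β 0 A := by
  obtain ⟨μf, hμf, -, hcorr⟩ := exists_freeMeasure_holds d (β := β) 0 hβ le_rfl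
  rw [huniq.1 hμ hμf]
  exact hcorr A

/-- **Newman's Gaussian inequality for the unique DLR state** (the lower inequality
`S_β(x₁,…,x_{2n}) ≤ 𝒢_n[S_β](x₁,…,x_{2n})` of Aizenman–Duminil-Copin 2021, §6.3, first display,
p. 26): if `|𝒢(β,0)| = 1` (`β ≥ 0`), every `μ ∈ 𝒢(β,0)` satisfies `PairingLowerBound μ` — the
finite-volume theorem `aizenman_nPoint_le_pairingSum_finite_holds` passed to the free box limits
(`pairingLowerBound_of_finite`). [cite: AizenmanDuminilCopinAnnals2021, arXiv:1912.07973 §6.3, first display, lower inequality (p. 26)] -/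
theorem pairingLowerBound_of_hasUniqueGibbsMeasure {β : ℝ} (hβ : 0 ≤ β)
    (huniq : HasUniqueGibbsMeasure (isingSpecification (zdGraph d) β 0))
    {μ : Measure (SpinConfig (Site d))} (hμ : μ ∈ isingGibbsMeasures d β 0) :
    PairingLowerBound μ :=
  pairingLowerBound_of_finite aizenman_nPoint_le_pairingSum_finite_holds hβ
    (spinCorr_eq_freeCorr_of_hasUniqueGibbsMeasure hβ huniq hμ)

/-! ### The unconditional cases: `β < β_c` (`d ≥ 2`), and `β ≤ β_c` for `d ≥ 3` -/

/-- **Newman's Gaussian inequality below `β_c`, unconditionally**: for `d ≥ 2`, `0 ≤ β < β_c(d)` and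
every `μ ∈ 𝒢(β,0)`, `⟨σ_{x₁}⋯σ_{x_{2n}}⟩_μ ≤ 𝒢_n[⟨σσ⟩_μ](x)` for all `n ≥ 2` (uniqueness below `β_c`:
`hasUniqueGibbsMeasure_of_lt_criticalBeta_holds`). [cite: AizenmanDuminilCopinAnnals2021, arXiv:1912.07973 §6.3, first display, lower inequality (p. 26)] -/
theorem pairingLowerBound_of_lt_criticalBeta (hd : 2 ≤ d) {β : ℝ} (hβ : 0 ≤ β)
    (hlt : β < criticalBeta d) {μ : Measure (SpinConfig (Site d))}
    (hμ : μ ∈ isingGibbsMeasures d β 0) : PairingLowerBound μ :=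
  pairingLowerBound_of_hasUniqueGibbsMeasure hβ
    (hasUniqueGibbsMeasure_of_lt_criticalBeta_holds hd hβ hlt) hμ

/-- **Newman's Gaussian inequality up to and including `β_c`, `d ≥ 3`, unconditionally**: for
`0 ≤ β ≤ β_c(d)` and every `μ ∈ 𝒢(β,0)`, `PairingLowerBound μ` (uniqueness below `β_c`, and at `β_c`
for `d ≥ 3`: `hasUniqueGibbsMeasure_criticalBeta_holds`, Aizenman–Duminil-Copin–Sidoravicius 2015).
This is the first display (lower inequality) of Aizenman–Duminil-Copin 2021, §6.3, for the states
to which the paper applies it (`d = 4`). [cite: AizenmanDuminilCopinAnnals2021, arXiv:1912.07973 §6.3, first display, lower inequality (p. 26)] -/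
theorem pairingLowerBound_of_le_criticalBeta (hd : 3 ≤ d) {β : ℝ} (hβ : 0 ≤ β)
    (hβc : β ≤ criticalBeta d) {μ : Measure (SpinConfig (Site d))}
    (hμ : μ ∈ isingGibbsMeasures d β 0) : PairingLowerBound μ := by
  rcases hβc.lt_or_eq with hlt | rfl
  · exact pairingLowerBound_of_lt_criticalBeta (by omega) hβ hlt hμ
  · exact pairingLowerBound_of_hasUniqueGibbsMeasure hβ (hasUniqueGibbsMeasure_criticalBeta_holds hd) hμ

/-- **Gaussian domination of the even moments below `β_c`, unconditionally** (the conclusion of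
`newman_evenMoment_le` for `0 ≤ β < β_c(d)`, `d ≥ 2`): for every `μ ∈ 𝒢(β,0)`, `L > 0`, every
compactly supported `f ≥ 0` and every `n`, `⟨T_{f,L}^{2n}⟩_μ ≤ (2n)!/(2ⁿ n!) ⟨T_{f,L}²⟩_μⁿ`
(Aizenman–Duminil-Copin 2021, §6.3, the lower inequality of the first display smeared against
`∏ᵢ f(xᵢ/L) ≥ 0`). [cite: AizenmanDuminilCopinAnnals2021, arXiv:1912.07973 §6.3, first display, lower inequality (p. 26)] -/
theorem integral_normalizedField_pow_le_wick_of_lt_criticalBeta (hd : 2 ≤ d) {β L : ℝ}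
    (hβ : 0 ≤ β) (hlt : β < criticalBeta d) (hL : 0 < L) {μ : Measure (SpinConfig (Site d))}
    (hμ : μ ∈ isingGibbsMeasures d β 0) {f : EuclideanSpace ℝ (Fin d) → ℝ}
    (hfs : HasCompactSupport f) (hf0 : ∀ x, 0 ≤ f x) (n : ℕ) :
    ∫ σ, normalizedField μ L f σ ^ (2 * n) ∂μ ≤
      ((2 * n)! : ℝ) / (2 ^ n * n !) * (∫ σ, normalizedField μ L f σ ^ 2 ∂μ) ^ n := by
  haveI : IsProbabilityMeasure μ := hμ.1
  exact integral_normalizedField_pow_le_of_pairingLowerBound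
    (pairingLowerBound_of_lt_criticalBeta hd hβ hlt hμ) hL hfs hf0 n

/-- **Gaussian domination of the even moments up to and including `β_c`, `d ≥ 3`,
unconditionally** (the conclusion of `newman_evenMoment_le` for `0 ≤ β ≤ β_c(d)`, `d ≥ 3`, in
particular for `d = 4` and `d ≥ 5` where the tree uses it): for every `μ ∈ 𝒢(β,0)`, `L > 0`, every
compactly supported `f ≥ 0` and every `n`, `⟨T_{f,L}^{2n}⟩_μ ≤ (2n)!/(2ⁿ n!) ⟨T_{f,L}²⟩_μⁿ`
(Aizenman–Duminil-Copin 2021, §6.3, first display, lower inequality, smeared; this gives the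
prefactor `exp(z²⟨T²⟩/2)` of the third display of §6.3). [cite: AizenmanDuminilCopinAnnals2021, arXiv:1912.07973 §6.3, first display, lower inequality (p. 26)] -/
theorem integral_normalizedField_pow_le_wick_of_three_le (hd : 3 ≤ d) {β L : ℝ}
    (hβ : 0 ≤ β) (hβc : β ≤ criticalBeta d) (hL : 0 < L) {μ : Measure (SpinConfig (Site d))}
    (hμ : μ ∈ isingGibbsMeasures d β 0) {f : EuclideanSpace ℝ (Fin d) → ℝ}
    (hfs : HasCompactSupport f) (hf0 : ∀ x, 0 ≤ f x) (n : ℕ) :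
    ∫ σ, normalizedField μ L f σ ^ (2 * n) ∂μ ≤
      ((2 * n)! : ℝ) / (2 ^ n * n !) * (∫ σ, normalizedField μ L f σ ^ 2 ∂μ) ^ n := by
  haveI : IsProbabilityMeasure μ := hμ.1
  exact integral_normalizedField_pow_le_of_pairingLowerBound
    (pairingLowerBound_of_le_criticalBeta hd hβ hβc hμ) hL hfs hf0 n

/-! ### The full facts from uniqueness at the planar critical point -/

/-- **Aizenman's lower inequality for all `d ≥ 2`, `β ≤ β_c`, from uniqueness at `(2, β_c(2))`.**
If the planar model has a unique Gibbs measure at its critical point (zero field), then the named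
fact `aizenman_nPoint_le_pairingSum` of `HighDimTrivialityWick` holds: the cases `β < β_c` and
`β = β_c`, `d ≥ 3` are unconditional (`pairingLowerBound_of_lt_criticalBeta`,
`pairingLowerBound_of_le_criticalBeta`), and the remaining case `d = 2`, `β = β_c(2)` is the
hypothesis, through `pairingLowerBound_of_hasUniqueGibbsMeasure`. [cite: AizenmanDuminilCopinAnnals2021, arXiv:1912.07973 §6.3, first display, lower inequality (p. 26)] -/
theorem aizenman_nPoint_le_pairingSum_of_hasUniqueGibbsMeasure_two
    (h₂ : HasUniqueGibbsMeasure (isingSpecification (zdGraph 2) (criticalBeta 2) 0)) :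
    aizenman_nPoint_le_pairingSum := by
  intro d hd β hβ hβc μ hμ
  rcases hβc.lt_or_eq with hlt | rfl
  · exact pairingLowerBound_of_lt_criticalBeta hd hβ hlt hμ
  · rcases Nat.lt_or_ge d 3 with hd3 | hd3
    · obtain rfl : d = 2 := by omega
      exact pairingLowerBound_of_hasUniqueGibbsMeasure hβ h₂ hμ
    · exact pairingLowerBound_of_le_criticalBeta hd3 hβ le_rfl hμ

/-- **Aizenman's lower inequality for all `d ≥ 2`, `β ≤ β_c`, from the continuity of the planar
magnetisation**: if `m*(β_c(2)) = 0` on `ℤ²` (Yang 1952; Aizenman–Duminil-Copin–Sidoravicius 2015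
discuss the planar case in §1.4), then `aizenman_nPoint_le_pairingSum` holds
(`m* = 0 ⇒` uniqueness, `hasUniqueGibbsMeasure_of_spontaneousMagnetization_eq_zero`). [cite: AizenmanDuminilCopinAnnals2021, arXiv:1912.07973 §6.3, first display, lower inequality (p. 26)] -/
theorem aizenman_nPoint_le_pairingSum_of_planarContinuity
    (h₂ : spontaneousMagnetization 2 (criticalBeta 2) = 0) : aizenman_nPoint_le_pairingSum :=
  aizenman_nPoint_le_pairingSum_of_hasUniqueGibbsMeasure_two
    (hasUniqueGibbsMeasure_of_spontaneousMagnetization_eq_zero (criticalBeta_nonneg 2) h₂)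

/-- **Aizenman's lower inequality for all `d ≥ 2`, `β ≤ β_c`, from the two planar named facts**
`criticalBeta_two` (`β_c(2) = ½ log(1+√2)`) and `spontaneousMagnetization_two_criticalBetaTwo`
(`m*(½ log(1+√2)) = 0`) of `PlanarIsing`. [cite: AizenmanDuminilCopinAnnals2021, arXiv:1912.07973 §6.3, first display, lower inequality (p. 26)] -/
theorem aizenman_nPoint_le_pairingSum_of_planar_facts (h₁ : criticalBeta_two)
    (h₂ : spontaneousMagnetization_two_criticalBetaTwo) : aizenman_nPoint_le_pairingSum :=
  aizenman_nPoint_le_pairingSum_of_planarContinuity (by rw [h₁]; exact h₂)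

/-- **`newman_evenMoment_le` from uniqueness at the planar critical point**: if
`|𝒢(β_c(2), 0)| = 1` on `ℤ²`, the named fact `newman_evenMoment_le` of `HighDimTrivialityMoments`
holds (every other ingredient is a theorem: `aizenman_nPoint_le_pairingSum_of_hasUniqueGibbsMeasure_two`
and the smearing `newman_evenMoment_le_of_pointwise`). [cite: AizenmanDuminilCopinAnnals2021, arXiv:1912.07973 §6.3, first display, lower inequality (p. 26)] -/
theorem newman_evenMoment_le_of_hasUniqueGibbsMeasure_two
    (h₂ : HasUniqueGibbsMeasure (isingSpecification (zdGraph 2) (criticalBeta 2) 0)) :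
    newman_evenMoment_le :=
  newman_evenMoment_le_of_pointwise (aizenman_nPoint_le_pairingSum_of_hasUniqueGibbsMeasure_two h₂)

/-- **`newman_evenMoment_le` from the continuity of the planar magnetisation** `m*(β_c(2)) = 0`. [cite: AizenmanDuminilCopinAnnals2021, arXiv:1912.07973 §6.3, first display, lower inequality (p. 26)] -/
theorem newman_evenMoment_le_of_planarContinuity
    (h₂ : spontaneousMagnetization 2 (criticalBeta 2) = 0) : newman_evenMoment_le :=
  newman_evenMoment_le_of_pointwise (aizenman_nPoint_le_pairingSum_of_planarContinuity h₂)

/-- **`newman_evenMoment_le` from the two planar named facts** `criticalBeta_two` and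
`spontaneousMagnetization_two_criticalBetaTwo` of `PlanarIsing` (Onsager–Yang: Yang 1952;
Benettin–Gallavotti–Jona-Lasinio–Stella 1973): the discharge `newman_evenMoment_le_holds` is this
theorem applied to their discharges. [cite: AizenmanDuminilCopinAnnals2021, arXiv:1912.07973 §6.3, first display, lower inequality (p. 26)] -/
theorem newman_evenMoment_le_of_planar_facts (h₁ : criticalBeta_two)
    (h₂ : spontaneousMagnetization_two_criticalBetaTwo) : newman_evenMoment_le :=
  newman_evenMoment_le_of_pointwise (aizenman_nPoint_le_pairingSum_of_planar_facts h₁ h₂)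

end Literature.Probability.LatticeModels

end
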